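import Summits.Ventures.Crystal3D.Theorems.StickyWulffConstantCoaxialWallLawWordInstanceNoTop
import Summits.Ventures.Crystal3D.Theorems.StickyWulffConstantCoaxialWallLawExactCount
import Summits.Ventures.Crystal3D.Theorems.StickyWulffConstantCoaxialWallLawEndCharge
import Summits.Ventures.Crystal3D.Theorems.StickyWulffConstantCoaxialWallLawEndMult
import HarnessLib

/-!
# Exact end accounting for the word automaton, VI: the in-plane instance — sources ≤ 22·#unsaturated + 220·rims

HONEST FRAMING. Part of the venture `Summits/Ventures/Crystal3D` (cell `crystal3d-full`), helper for the crux
`CoaxialWallLaw` (stmt-Ventures-19481) of `route-Ventures-StickyWulffConstant`, REGISTERED line `WallLedgerF`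
(planner cf-p1 gen 16), open stub `stub_coaxialTwoSlabAdhesion` (general fillings).  Rung credit only; F-C1 not
moved.  The instantiated form of the EXACT END ACCOUNTING (`…ExactCount` + `…EndCharge` + `…EndMult`) for the
IN-PLANE-rooted word automaton of a twin pair — the sibling of `word_sources_le_lists_noTop`
(`…WordInstanceNoTop`, whose hypotheses it shares verbatim, minus the kissing facts, plus the two E1 rows):

**Theorem (`word_sources_le_lists_exact`).**  Word data `F, u, WF, next` (any root model slot `u []`), a unit
model menu normal `m` orthogonal to the root slot, the top grain as a frame `G₂` with slot dozen
`(F [] ∘ R_m) '' fccSlots`, rising root direction, the two-slab cell; the E1 rows C12-55 (`hcert`) and the A12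
glide star (`hcertA`) BY NAME.  Then the vertical tops of the inner bottom sample along `F [] (u [])` number at
most

  `22 · #{z ∈ X : deg z ≤ 11, window} + 220 · #rim_top + 220 · #rim_bottom`

instead of `13·220 · #{…} + rims`: every reachable end pays at its own (unsaturated, `word_reachable_end_le_eleven`)
ball, and at most `2 · 11` reachable states sit at an unsaturated ball (`card_reached_at_le`).  NO kissing facts
are used (the E1 rows replace them at the ends; the rest is move algebra, sealing and word rigidity).

WHAT THIS IS NOT: not the stub; the cell/twin assembly with the sharp in-plane slot is the next brick (constant
`√6/88 · sin θ` in place of `√6/11440 · sin θ`); the sharp multiplicity (k-fold tops) is not attempted; F-C1 not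
moved.
-/

noncomputable section

namespace Summit.Ventures.Crystal3D.Theorems

open Summit.Ventures.Crystal3D Finset
open Literature.MathematicalPhysics.StatisticalMechanics (fccStacking)
open scoped InnerProductSpace

section Instance

variable {X : Finset (EuclideanSpace ℝ (Fin 3))}
  {F : List (EuclideanSpace ℝ (Fin 3)) → (EuclideanSpace ℝ (Fin 3) ≃ₗᵢ[ℝ] EuclideanSpace ℝ (Fin 3))}
  {u : List (EuclideanSpace ℝ (Fin 3)) → EuclideanSpace ℝ (Fin 3)}
  {WF : List (EuclideanSpace ℝ (Fin 3)) → Prop}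
  {next : List (EuclideanSpace ℝ (Fin 3)) → EuclideanSpace ℝ (Fin 3) → List (EuclideanSpace ℝ (Fin 3))}
  {P₁ P' P₂ : Finset (EuclideanSpace ℝ (Fin 3))} {t₁ t₂ : EuclideanSpace ℝ (Fin 3)} {R₀ h ρ : ℝ}

open scoped Classical in
/-- **The exact in-plane count, instantiated for well-formed words.**  See the module docstring. -/
theorem word_sources_le_lists_exact
    (hX : ∀ p ∈ X, ∀ q ∈ X, p ≠ q → 1 ≤ dist p q)
    -- the two E1 rows, BY NAME
    {s₀ : EuclideanSpace ℝ (Fin 3)} (hs₀ : s₀ ∈ fccSlots)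
    (hcert : ExactOnly 0 (fccSlots.filter fun w => 0 < ⟪w, s₀⟫_ℝ))
    (hcertA : ∀ (A : EuclideanSpace ℝ (Fin 3) ≃ₗᵢ[ℝ] EuclideanSpace ℝ (Fin 3)) (n : EuclideanSpace ℝ (Fin 3)),
      ‖n‖ = 1 → (∀ w ∈ fccSlots, ⟪A w, n⟫_ℝ = 0 ∨ ⟪A w, n⟫_ℝ = Real.sqrt (2 / 3) ∨ ⟪A w, n⟫_ℝ = -Real.sqrt (2 / 3)) →
      ∀ u ∈ fccSlots, ⟪A u, n⟫_ℝ = 0 → ∀ b : EuclideanSpace ℝ (Fin 3),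
      ExactOnly b (insert (b - A u)
        (((fccSlots.filter fun s => ⟪s, u⟫_ℝ = -(1 / 2) ∧ ⟪A (u + s), n⟫_ℝ ≤ 0).image (fun s => b + A s)) ∪
          ((fccSlots.filter fun s => ⟪s, u⟫_ℝ = -(1 / 2) ∧ ⟪A (u + s), n⟫_ℝ < 0).image
            (fun s => b + (A s - (2 * ⟪A s, n⟫_ℝ) • n))))))
    (hFc : ∀ μ κ, F (μ :: κ) = ((ℝ ∙ μ)ᗮ.reflection).trans (F κ))
    (hu : ∀ κ, u κ ∈ fccSlots) (huc : ∀ μ κ, u (μ :: κ) = -u κ)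
    (hWF0 : WF [])
    (hWFc : ∀ μ κ, WF (μ :: κ) ↔ (WF κ ∧ ‖μ‖ = 1 ∧
      (∀ w ∈ fccSlots, ⟪w, μ⟫_ℝ = 0 ∨ ⟪w, μ⟫_ℝ = Real.sqrt (2 / 3) ∨ ⟪w, μ⟫_ℝ = -Real.sqrt (2 / 3)) ∧
      ⟪u κ, μ⟫_ℝ = Real.sqrt (2 / 3) ∧ ∀ μ' κ', κ = μ' :: κ' → μ' ≠ -μ))
    (hnext_pop : ∀ μ κ' (m : EuclideanSpace ℝ (Fin 3)), (F (μ :: κ')).symm m = -μ → next (μ :: κ') m = κ')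
    (hnext_push : ∀ κ (m : EuclideanSpace ℝ (Fin 3)), (∀ μ κ', κ = μ :: κ' → (F κ).symm m ≠ -μ) →
      next κ m = (F κ).symm m :: κ)
    -- the in-plane root and the top grain's frame (a twin across the `m`-planes)
    {m : EuclideanSpace ℝ (Fin 3)} (hm : ‖m‖ = 1)
    (hmenu : ∀ w ∈ fccSlots, ⟪w, m⟫_ℝ = 0 ∨ ⟪w, m⟫_ℝ = Real.sqrt (2 / 3) ∨ ⟪w, m⟫_ℝ = -Real.sqrt (2 / 3))
    (horth : ⟪u [], m⟫_ℝ = 0)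
    (G₂ : EuclideanSpace ℝ (Fin 3) ≃ₗᵢ[ℝ] EuclideanSpace ℝ (Fin 3))
    (hG₂ : (G₂ : EuclideanSpace ℝ (Fin 3) → EuclideanSpace ℝ (Fin 3)) '' ↑fccSlots =
      (fun x => F [] (x - (2 * ⟪x, m⟫_ℝ) • m)) '' ↑fccSlots)
    (hup : 0 < (F [] (u [])) 2)
    -- the cell
    (hR₀ : 3 ≤ R₀) (hρ : R₀ ≤ ρ)
    (hcell : ∀ p ∈ X, -(2 * R₀) ≤ p 2 ∧ p 2 ≤ h + 2 * R₀ ∧ p 0 ^ 2 + p 1 ^ 2 ≤ ρ ^ 2)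
    (hP₁X : P₁ ⊆ X) (hP₂X : P₂ ⊆ X)
    (hP₁ : ∀ p, p ∈ P₁ ↔ (p ∈ (fun q => F [] q + t₁) '' fccStacking 1 (Real.sqrt (2 / 3)) ∧
      -(2 * R₀) ≤ p 2 ∧ p 2 ≤ -R₀ ∧ p 0 ^ 2 + p 1 ^ 2 ≤ ρ ^ 2))
    (hP' : ∀ p, p ∈ P' ↔ (p ∈ (fun q => F [] q + t₁) '' fccStacking 1 (Real.sqrt (2 / 3)) ∧
      -(2 * R₀) + 1 ≤ p 2 ∧ p 2 ≤ -R₀ - 1 ∧ p 0 ^ 2 + p 1 ^ 2 ≤ (ρ - 1) ^ 2))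
    (hP'full : ∀ p ∈ P', ∀ w ∈ fccSlots, p + F [] w ∈ X)
    (hP₂ : ∀ p, p ∈ P₂ ↔ (p ∈ (fun q => G₂ q + t₂) '' fccStacking 1 (Real.sqrt (2 / 3)) ∧
      h + R₀ ≤ p 2 ∧ p 2 ≤ h + 2 * R₀ ∧ p 0 ^ 2 + p 1 ^ 2 ≤ ρ ^ 2)) :
    (P'.filter fun p => (∀ w ∈ fccSlots, p + F [] w ∈ X) ∧
        -R₀ - 1 < (p + F [] (u [])) 2 ∧ (p + F [] (u [])) 2 < h + R₀ + 1).card ≤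
      22 * (X.filter fun z => (X.filter fun q => dist z q = 1).card ≤ 11 ∧
          -R₀ - 1 - 1 ≤ z 2 ∧ z 2 ≤ h + R₀ + 1 + 1).card +
      220 * (X.filter fun s => h + R₀ + 1 ≤ s 2 ∧ s 2 ≤ h + R₀ + 1 + 1 ∧ (ρ - 2) ^ 2 < s 0 ^ 2 + s 1 ^ 2).card +
      220 * (X.filter fun s => -R₀ - 1 - 1 ≤ s 2 ∧ s 2 < -R₀ - 1 ∧ (ρ - 1) ^ 2 < s 0 ^ 2 + s 1 ^ 2).card := by
  -- the class data on the subtype of well-formed words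
  set F' : {κ : List (EuclideanSpace ℝ (Fin 3)) // WF κ} →
      (EuclideanSpace ℝ (Fin 3) ≃ₗᵢ[ℝ] EuclideanSpace ℝ (Fin 3)) := fun κ => F κ.1 with hF'
  set d' : {κ : List (EuclideanSpace ℝ (Fin 3)) // WF κ} → EuclideanSpace ℝ (Fin 3) :=
    fun κ => F κ.1 (u κ.1) with hd'
  set next' : {κ : List (EuclideanSpace ℝ (Fin 3)) // WF κ} → EuclideanSpace ℝ (Fin 3) →
      {κ : List (EuclideanSpace ℝ (Fin 3)) // WF κ} := fun κ m =>
    @dite _ (WF (next κ.1 m)) (Classical.propDecidable _) (fun hw => ⟨next κ.1 m, hw⟩) (fun _ => κ) with hnext'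
  set root : {κ : List (EuclideanSpace ℝ (Fin 3)) // WF κ} := ⟨[], hWF0⟩ with hroot_def
  -- the class change along a crossing normal
  have hspec : ∀ (κ : {κ : List (EuclideanSpace ℝ (Fin 3)) // WF κ}) (m : EuclideanSpace ℝ (Fin 3)), ‖m‖ = 1 →
      (∀ w ∈ fccSlots, ⟪F' κ w, m⟫_ℝ = 0 ∨ ⟪F' κ w, m⟫_ℝ = Real.sqrt (2 / 3) ∨ ⟪F' κ w, m⟫_ℝ = -Real.sqrt (2 / 3)) →
      ⟪d' κ, m⟫_ℝ = Real.sqrt (2 / 3) →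
      (next' κ m).1 = next κ.1 m ∧ (∀ x, F (next κ.1 m) x = F κ.1 x - (2 * ⟪F κ.1 x, m⟫_ℝ) • m) ∧
        ⟪F (next κ.1 m) (u (next κ.1 m)), m⟫_ℝ = Real.sqrt (2 / 3) ∧ next (next κ.1 m) m = κ.1 := by
    intro κ m hm hmenu hdm
    obtain ⟨hwf, hfr, hdir, hinv⟩ := word_next_spec hFc huc hWFc hnext_pop hnext_push κ.2 hm hmenu hdm
    refine ⟨?_, hfr, hdir, hinv⟩
    simp only [hnext']
    rw [dif_pos hwf]
  have hmirror : ∀ (κ : {κ : List (EuclideanSpace ℝ (Fin 3)) // WF κ}) (m : EuclideanSpace ℝ (Fin 3)), ‖m‖ = 1 →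
      (∀ w ∈ fccSlots, ⟪F' κ w, m⟫_ℝ = 0 ∨ ⟪F' κ w, m⟫_ℝ = Real.sqrt (2 / 3) ∨ ⟪F' κ w, m⟫_ℝ = -Real.sqrt (2 / 3)) →
      ⟪d' κ, m⟫_ℝ = Real.sqrt (2 / 3) → ∀ x, F' (next' κ m) x = F' κ x - (2 * ⟪F' κ x, m⟫_ℝ) • m := by
    intro κ m hm hmenu hdm x
    obtain ⟨h1, hfr, -, -⟩ := hspec κ m hm hmenu hdm
    show F (next' κ m).1 x = F κ.1 x - (2 * ⟪F κ.1 x, m⟫_ℝ) • m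
    rw [h1]; exact hfr x
  have hinv : ∀ (κ : {κ : List (EuclideanSpace ℝ (Fin 3)) // WF κ}) (m : EuclideanSpace ℝ (Fin 3)), ‖m‖ = 1 →
      (∀ w ∈ fccSlots, ⟪F' κ w, m⟫_ℝ = 0 ∨ ⟪F' κ w, m⟫_ℝ = Real.sqrt (2 / 3) ∨ ⟪F' κ w, m⟫_ℝ = -Real.sqrt (2 / 3)) →
      ⟪d' κ, m⟫_ℝ = Real.sqrt (2 / 3) → next' (next' κ m) m = κ := by
    intro κ m hm hmenu hdm
    obtain ⟨h1, -, -, hback⟩ := hspec κ m hm hmenu hdm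
    apply Subtype.ext
    have h2 : (next' (next' κ m) m).1 = next (next' κ m).1 m := by
      simp only [hnext']
      rw [dif_pos]
      rw [h1, hback]; exact κ.2
    rw [h2, h1, hback]
  have hdnext : ∀ (κ : {κ : List (EuclideanSpace ℝ (Fin 3)) // WF κ}) (m : EuclideanSpace ℝ (Fin 3)), ‖m‖ = 1 →
      (∀ w ∈ fccSlots, ⟪F' κ w, m⟫_ℝ = 0 ∨ ⟪F' κ w, m⟫_ℝ = Real.sqrt (2 / 3) ∨ ⟪F' κ w, m⟫_ℝ = -Real.sqrt (2 / 3)) →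
      ⟪d' κ, m⟫_ℝ = Real.sqrt (2 / 3) → ⟪d' (next' κ m), m⟫_ℝ = Real.sqrt (2 / 3) := by
    intro κ m hm hmenu hdm
    obtain ⟨h1, -, hdir, -⟩ := hspec κ m hm hmenu hdm
    show ⟪F (next' κ m).1 (u (next' κ m).1), m⟫_ℝ = Real.sqrt (2 / 3)
    rw [h1]; exact hdir
  have hd : ∀ κ : {κ : List (EuclideanSpace ℝ (Fin 3)) // WF κ}, ∃ u' ∈ fccSlots, d' κ = F' κ u' :=
    fun κ => ⟨u κ.1, hu κ.1, rfl⟩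
  have hdn : ∀ κ : {κ : List (EuclideanSpace ℝ (Fin 3)) // WF κ}, ∃ m : EuclideanSpace ℝ (Fin 3), ‖m‖ = 1 ∧
      (∀ w ∈ fccSlots, ⟪F' κ w, m⟫_ℝ = 0 ∨ ⟪F' κ w, m⟫_ℝ = Real.sqrt (2 / 3) ∨ ⟪F' κ w, m⟫_ℝ = -Real.sqrt (2 / 3)) ∧
      ⟪d' κ, m⟫_ℝ = Real.sqrt (2 / 3) := fun κ => exists_menuNormal_far (F κ.1) (hu κ.1)
  -- rigidity: the slot dozen determines the word
  have hinjK : ∀ κ κ' : {κ : List (EuclideanSpace ℝ (Fin 3)) // WF κ},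
      (F' κ : EuclideanSpace ℝ (Fin 3) → EuclideanSpace ℝ (Fin 3)) '' ↑fccSlots =
      (F' κ' : EuclideanSpace ℝ (Fin 3) → EuclideanSpace ℝ (Fin 3)) '' ↑fccSlots → κ = κ' :=
    fun κ κ' himg => Subtype.ext (word_eq_of_image_eq hFc huc hWFc κ.2 κ'.2 himg)
  have hrig : ∀ κ κ' : {κ : List (EuclideanSpace ℝ (Fin 3)) // WF κ},
      (∃ a ∈ fccSlots, ∃ a' ∈ fccSlots, ∃ a'' ∈ fccSlots,
        ⟪a, a'⟫_ℝ = 1 / 2 ∧ ⟪a, a''⟫_ℝ = 1 / 2 ∧ ⟪a', a''⟫_ℝ = 1 / 2 ∧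
        (∃ w ∈ fccSlots, F' κ' w = F' κ a) ∧ (∃ w ∈ fccSlots, F' κ' w = F' κ a') ∧
        (∃ w ∈ fccSlots, F' κ' w = F' κ a'')) → κ = κ' :=
    fun κ κ' htri => Subtype.ext (word_eq_of_triangle hFc huc hWFc κ.2 κ'.2 htri)
  -- the certified states and the move map
  obtain ⟨W, hW, hmult⟩ := exists_certified_states (F := F') (d := d') hX hinjK
  obtain ⟨f, hf_full, hf_cross, hf_glide⟩ := exists_word_move_map X F' d' next'
  -- no well-formed word carries the top grain's slots (in-plane root)
  have hnotop : ∀ κ : {κ : List (EuclideanSpace ℝ (Fin 3)) // WF κ},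
      ¬ (∃ a ∈ fccSlots, ∃ a' ∈ fccSlots, ∃ a'' ∈ fccSlots,
        ⟪a, a'⟫_ℝ = 1 / 2 ∧ ⟪a, a''⟫_ℝ = 1 / 2 ∧ ⟪a', a''⟫_ℝ = 1 / 2 ∧
        (∃ w ∈ fccSlots, G₂ w = F' κ a) ∧ (∃ w ∈ fccSlots, G₂ w = F' κ a') ∧
        (∃ w ∈ fccSlots, G₂ w = F' κ a'')) :=
    fun κ => word_noTop_of_inner_zero hFc huc hWFc hm hmenu horth G₂ hG₂ κ.2
  -- no certified state sits on a full `G₂`-shell (it would have a triangle in `G₂`'s slots)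
  have hPexcl : ∀ v ∈ W, True → v.1 ∈ P₂ → (∀ w ∈ fccSlots, v.1 + G₂ w ∈ X) → False := by
    intro v hv _ _ hGfull
    obtain ⟨-, ⟨a, ha, a', ha', a'', ha'', i1, i2, i3, h1, h2, h3⟩, -⟩ := (hW v).1 hv
    refine hnotop v.2 ⟨a, ha, a', ha', a'', ha'', i1, i2, i3, ?_, ?_, ?_⟩
    · exact shell_slot_of_full hX G₂ hGfull h1 (by rw [LinearIsometryEquiv.norm_map, norm_eq_one_of_mem_fccSlots ha])
    · exact shell_slot_of_full hX G₂ hGfull h2 (by rw [LinearIsometryEquiv.norm_map, norm_eq_one_of_mem_fccSlots ha'])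
    · exact shell_slot_of_full hX G₂ hGfull h3 (by rw [LinearIsometryEquiv.norm_map, norm_eq_one_of_mem_fccSlots ha''])
  -- the abstract exact count with the trivial state invariant
  have key := word_sources_le_exact (root := root) (G₂ := G₂) (P := fun _ => True) hX hd hdn hmirror hinv hdnext hW
    hmult (fun v _ => hf_full v) (fun v _ => hf_cross v) (fun v _ => hf_glide v)
    (fun κ hκ => hrig κ root hκ) hup (fun _ _ _ => trivial) (fun _ _ _ => trivial)
    (fun _ _ _ _ _ _ _ => trivial) hPexcl hR₀ hρ hcell hP₁X hP₂X hP₁ hP' hP'full hP₂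
  -- the reachable ends: each sits on an unsaturated ball of the window, at most 22 per ball
  set mov : EuclideanSpace ℝ (Fin 3) × {κ : List (EuclideanSpace ℝ (Fin 3)) // WF κ} → Prop := fun v =>
    (∀ w ∈ fccSlots, v.1 + F' v.2 w ∈ X) ∨
      ∃ m : EuclideanSpace ℝ (Fin 3), ‖m‖ = 1 ∧
        (∀ w ∈ fccSlots, ⟪F' v.2 w, m⟫_ℝ = 0 ∨ ⟪F' v.2 w, m⟫_ℝ = Real.sqrt (2 / 3) ∨ ⟪F' v.2 w, m⟫_ℝ = -Real.sqrt (2 / 3)) ∧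
        (∀ w ∈ fccSlots, ⟪F' v.2 w, m⟫_ℝ ≤ 0 → v.1 + F' v.2 w ∈ X) ∧
        (∀ w ∈ fccSlots, ⟪F' v.2 w, m⟫_ℝ < 0 → v.1 + (F' v.2 w - (2 * ⟪F' v.2 w, m⟫_ℝ) • m) ∈ X) ∧
        (∀ w ∈ fccSlots, 0 < ⟪F' v.2 w, m⟫_ℝ → v.1 + F' v.2 w ∉ X) ∧
        (⟪d' v.2, m⟫_ℝ = Real.sqrt (2 / 3) ∨ ⟪d' v.2, m⟫_ℝ = 0) with hmov
  -- the end set of the abstract count, in membership form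
  obtain ⟨E, hkey, hEmem⟩ : ∃ E : Finset (EuclideanSpace ℝ (Fin 3) × {κ : List (EuclideanSpace ℝ (Fin 3)) // WF κ}),
      (P'.filter fun p => (∀ w ∈ fccSlots, p + F [] w ∈ X) ∧
          -R₀ - 1 < (p + F [] (u [])) 2 ∧ (p + F [] (u [])) 2 < h + R₀ + 1).card ≤
        E.card +
        220 * (X.filter fun s => h + R₀ + 1 ≤ s 2 ∧ s 2 ≤ h + R₀ + 1 + 1 ∧ (ρ - 2) ^ 2 < s 0 ^ 2 + s 1 ^ 2).card +
        220 * (X.filter fun s => -R₀ - 1 - 1 ≤ s 2 ∧ s 2 < -R₀ - 1 ∧ (ρ - 1) ^ 2 < s 0 ^ 2 + s 1 ^ 2).card ∧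
      ∀ v, v ∈ E ↔ v ∈ W ∧ (-R₀ - 1 ≤ v.1 2 ∧ v.1 2 < h + R₀ + 1 ∧ ¬ mov v ∧ True ∧
        ∃ u ∈ W, mov u ∧ f u = v) :=
    ⟨_, key, fun v => by simp only [Finset.mem_filter, hmov]⟩
  set PAY := X.filter fun z => (X.filter fun q => dist z q = 1).card ≤ 11 ∧
    -R₀ - 1 - 1 ≤ z 2 ∧ z 2 ≤ h + R₀ + 1 + 1 with hPAY
  have hEpay : ∀ v ∈ E, v.1 ∈ PAY := by
    intro v hv
    obtain ⟨hvW, h1, h2, hnm, -, u', hu'W, hum, hfu⟩ := (hEmem v).1 hv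
    refine mem_filter.2 ⟨((hW v).1 hvW).1, ?_, by linarith, by linarith⟩
    rw [← hfu]
    rw [← hfu] at hnm
    exact word_reachable_end_le_eleven hX hs₀ hcert hcertA hd hdn hmirror hdnext hW (fun v _ => hf_full v)
      (fun v _ => hf_cross v) (fun v _ => hf_glide v) hu'W hum hnm
  have hEfib : ∀ z ∈ PAY, (E.filter fun v => v.1 = z).card ≤ 22 := by
    intro z hz
    have hdeg : (X.filter fun q => dist z q = 1).card ≤ 11 := (mem_filter.1 hz).2.1
    obtain ⟨T, hTcard, hTmem⟩ : ∃ T : Finset (EuclideanSpace ℝ (Fin 3) × {κ : List (EuclideanSpace ℝ (Fin 3)) // WF κ}),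
        T.card ≤ 2 * (X.filter fun q => dist z q = 1).card ∧
        ∀ v, v ∈ T ↔ v ∈ W ∧ (v.1 = z ∧ ∃ u ∈ W, mov u ∧ f u = v) :=
      ⟨_, card_reached_at_le hX hd hdn hmirror hdnext hW (fun v _ => hf_full v) (fun v _ => hf_cross v)
        (fun v _ => hf_glide v) hrig z, fun v => by simp only [Finset.mem_filter, hmov]⟩
    have hsub : (E.filter fun v => v.1 = z) ⊆ T := by
      intro v hv
      obtain ⟨hvE, hvz⟩ := mem_filter.1 hv
      obtain ⟨hvW, -, -, -, -, hu⟩ := (hEmem v).1 hvE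
      exact (hTmem v).2 ⟨hvW, hvz, hu⟩
    have := card_le_card hsub
    omega
  have hEcard : E.card ≤ 22 * PAY.card := by
    have hcov : E ⊆ PAY.biUnion fun z => E.filter fun v => v.1 = z := by
      intro v hv
      rw [mem_biUnion]
      exact ⟨v.1, hEpay v hv, mem_filter.2 ⟨hv, rfl⟩⟩
    calc E.card ≤ (PAY.biUnion fun z => E.filter fun v => v.1 = z).card := card_le_card hcov
      _ ≤ ∑ z ∈ PAY, (E.filter fun v => v.1 = z).card := card_biUnion_le
      _ ≤ ∑ z ∈ PAY, 22 := sum_le_sum hEfib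
      _ = 22 * PAY.card := by rw [sum_const, smul_eq_mul, mul_comm]
  exact hkey.trans (by omega)

end Instance

end Summit.Ventures.Crystal3D.Theorems

end
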